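import Summits.BirchSwinnertonDyer.Rank1Residual.F1Sign2.BlindSpotLocalLawsAtTwo
import HarnessLib
import Literature.NumberTheory.EllipticCurves.SelmerProofs
import Literature.NumberTheory.EllipticCurves.SelmerTorsionRestriction

/-!
# Cell `bsd-f1-sign2`, ES-22: THE SIGNED OBJECT AT 2 OF THE ČEBOTAREV BLIND SPOT IS THE HASSE INVARIANT — `loc₂ ξ_E` is Kummer at 2 iff `E` is supersingular at
2 (good reduction); explicit laws at multiplicative primes (-es g13, MEMO-es §22)

TYPER FILING (cell `bsd-f1-sign2`, seat `-ty` g11; -es g13 filing ask D-es-66-ty (18:02:46Z) «port `data-es/g13/Sketch22T.lean` as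
`F1Sign2/BlindSpotLocalLawsAtTwoGood.lean`; 8 Props BC7 CLEAN; elaborates rc 0 against p652787»; REF1 D-es-66 CLEARED by REF1-AUDIT-v1 §132
(refuter-bsd-f1-sign2-ref1 g12, 2026-08-28T18:54Z; all 10 typed Props SURVIVE A1–A6, BC7 10/10 CLEAN)): the sketch body
`HOME/data-es/g13/Sketch22T.lean` 2b3fc6e71d3445da VERBATIM — same namespace `…Rank1Residual.F1Sign2.BlindSpotLocalLawsAtTwoGood`, same imports (the in-tree
`F1Sign2/BlindSpotLocalLawsAtTwo.lean` p652787, whose frame `primePlace`, `DiesOnDivisionField` and law ES-21b₁ `BlindSpotNotKummerAtTwoOrdinary` are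
opened, not restated; `Literature…SelmerProofs`, `SelmerTorsionRestriction`) — decls: ES-22a `BlindSpotKummerAtTwoSupersingular` (Λ₂-ss, THEOREM by a
4-class finite 2-adic verification, residue-ring step kernel-checked by `decide` in `SsResidueCheck.lean`), ES-22a′ `BlindSpotLocallyTrivialAtTwoSupersingularIff`,
ES-22c `BlindSpotKummerAtSplitMultiplicativeIff`, ES-22d `BlindSpotKummerAtNonsplitMultiplicativeValFour`, ES-22e `BlindSpotKummerAtTwoIffSupersingular`
(the dichotomy) + glue `blindSpotKummerAtTwoIffSupersingular_of`, `not_mem_selmerLocalKer_of_ordinary`, `eq_zero_of_split_of_not_isSquare` (PROVED);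
the §22.12 global-reading rows `BlindSpotSelmerIffSupersingularOnThinFamily`, `ShaTwoNontrivialOfSupersingularOnThinFamily`,
`BlindSpotIsKummerImageOfSupersingularOfShaTwoTrivial` + glue `blindSpotIsKummerImage_of` (PROVED); the additive rows
`BlindSpotNotKummerAtTwoAdditiveUnramifiedCubic`, `BlindSpotKummerAtTwoAdditiveTameCubic` — all PLAIN support `def`s exactly as in the sketch (-es D-es-66-ty
«port»; REF1 §132 (6)(c) «port unaffected — plain defs»): ES-22a is a WORDS-THEOREM (frontier-ledger entry under the director ruling v4.0-add1: kernel currency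
only by a tree `theorem` or by-name consumption in a kernel closer), ES-22fα/fβ are conjecture-grade census sub-laws — grades recorded in prose, no attribute
added or removed.  ES-22b = the tree's ES-21b₁
`BlindSpotNotKummerAtTwoOrdinary` (p652787, `@[conjecture]`): PROOF STATUS after REF1 §132 — (a) Δ ≡ 1 (mod 4) paper-complete (Lemma A's corollary +
Lemma B, sh(K₂) = {1,5}); (b1) Δ ≡ 7 (mod 8) paper-complete WITH REF1's added valuation line r132-1; (b2) Δ ≡ 3 (mod 8) (157/451 ordinary rows) NOT
paper-complete — a theorem MODULO the census-certified K₂-coset fact (three engines: F21 PARI, engine22 python, REF1 kit j315449 `nfislocalpower`;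
157/157 rows, 1 727/1 727 points), closure targets r132-2 (pairing-free residue statement) / r132-3 (flat-cohomology rigidity: one certified 2-descent on
53a1 settles all Δ ≡ 3 (8)); F132-A: Lemma A is MISSTATED as a GL₂(ℤ/4)-identity (holds on B♭ = Stab(C₄ ∋ T°) ⊇ every ρ_{E,4}(G_{ℚ_v}) used; corollaries
intact; words-only, no typed decl affected).  Its attribute is NOT removed here (typer rule: no attribute removal; it flips when a kernel proof `_holds`
lands) — the status words are folded into p652787's docstring as a landing note separately.  Typer edits = this header, the tags, the REF1/REF2 sentences, and the sketch's
`set_option linter.dupNamespace false` dropped.  No instance, no notation.  Nothing here proves BSD.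
Census = BC5 WITNESS (TWO engines agreeing on every row: PARI job F21 kit j312155 (g12) v. the pure-python 2-adic engine `data-es/g13/es22/engine22.py`
(g13)): 451 ordinary, 505 supersingular (z_2: 308/197 as predicted by ES-22a′), 849 multiplicative-at-2 curves and 5 527 odd multiplicative (curve,
prime) instances, 0 exceptions; 2-adic re-filter (Dokchitser² 2011) 2 794/2 811 tower-onto, every law 0 exceptions on the subset
(`REFILTER-2ADIC.txt`); Q22: H¹(GL₂(ℤ/4),(ℤ/4)²) = ℤ/2 ⇒ Ш¹(ℚ,E[4]) = 0 for ρ_{E,4} onto (`q22_gl2z4.py`); §22.12: scan of ALL 574 222 odd-conductor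
Cremona curves: thin family 𝔉 (odd N, all odd bad primes additive, odd Tamagawa, Δ<0, ρ̄₄ onto) 132 members, b(E) = [ss at 2] 132/132 by global
invariants (`FAMILY-F.txt`).
REF1-AUDIT-v1 §132 (D-es-66, 18:54Z; evidence `REF1-data/b132/` SHA16.txt), one-line verdict verbatim: «Λ₂-ss/z₂-ss (ES-22a/a′) THEOREM-GRADE — reduction 22.4
(i)–(v) certified on paper, kernel step replayed (`SsResidueCheck.lean` f2e6d0b8ca9b2d88 rc 0, plain `decide`), and re-derived by a REF1 engine written from the
a-invariants (all 262 144 tuples (a₁,…,a₆) mod 16, a₁ even, a₃ odd: x₂ = 1 on all four (b₂ mod 8, b₄ mod 4) classes, z₂ = 1 exactly on [8 ∣ b₂ + 2b₄]); Q22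
CERTIFIED by an independent algorithm (cocycles on GL₂(ℤ/4) closed along words: H¹ = ℤ/2, Ш¹_cyc = 0); Λ₂-ord (ES-22b): Δ ≡ 1 (4) paper ✓, Δ ≡ 7 (8) paper ✓
WITH one added valuation line (r132-1), Δ ≡ 3 (8) NOT paper-complete (F132-C; REF1 concurs with REF2 ρ22-2 and localises the pinned bit on the Kummer side
K₂ ∩ sh⁻¹(5)); Lemma A MISSTATED as a GL₂(ℤ/4)-identity (F132-A; corollaries intact); a THIRD numeric engine (kit j315449) agrees with F21 on (x₂, z₂) for
956/956 good-at-2 rows and confirms ρ22-1 (κ ramified 505/505); 22.12(c)/22.13 «im δ₂ = M_{1,2}» KILLED-as-worded (REF2 ρ22-1 UPHELD); all 10 typed Props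
SURVIVE A1–A6/BC7.»  Per-decl (§132 (5)): ES-22a SURVIVES theorem-grade; ES-22a′ SURVIVES ((b₂ + 2b₄) mod 8 invariant under [±1; r,s,t] between minimal
models); ES-22e + glue ✓ (`IsOrdinaryAt W 2 ↔ good ∧ ¬ 2 ∣ frobeniusTrace` is `Iff.rfl`); ES-22c SURVIVES (x_p = 1 half paper via Lemma A as repaired +
K_p = im ι for the Tate curve; no census instance — D-es-69 stands); ES-22d SURVIVES (p ≠ 2 explicit; thin 5/5); ES-22g SURVIVES (local chain checked; on
𝔉_ord with Δ ≡ 3 (8) it inherits F132-C's status); ES-22h ✓ given ES-22g; ES-22i + glue ✓ (32/32 + 8/8); ES-22fα/fβ SURVIVE as typed (binder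
`∃ k m, W.Δ = 4^k*m ∧ m % 8 = 1` forces k = v₂(Δ)/2; conjecture-grade).  Vacuity: none (tower binder at n = 0 is the mod-1 representation, trivially
surjective; 2 794 F21 tower-onto witnesses); hidden hypotheses: none.  `rank1_control.py` filename fix: 22.6(2)'s control now covers 2 811/2 811 rows.
REF2 v38 §2 (refuter-bsd-f1-sign2-ref2 g38, `HOME/REF2-PLACEMENT-v38.md` d6ff418d2470cce0, 2026-08-28T18:24Z) + v39-add1 (19:00Z), placement verbatim in
substance: «VERDICT (a): ES-22a, a′, b, e, g, h, i are NOT IN PRINT as statements (no printed statement locates the Lawson–Wuthrich class, or any named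
non-Kummer element of H¹(ℚ,E[2]), relative to im δ₂ by reduction type; print at v = 2: Brumer–Kramer 1977 §3 via BPT 2021 Thm 1.7/1.10, BPT 2021 Lemma
1.9(3), Yoo–Yu 2022 Thm 1.6/1.10/1.11 («it is extremely difficult to exactly compute im(δ_{K_v}) … for an even prime v»), Chao Li 2019 Thm 1.1, Kramer 1981
Prop 1–2 / Mazur–Rubin 2010 L.2.3–2.4, 2.9–2.11, Lawson–Wuthrich 2016 §7.1); ES-22c/d are one Tate-curve line (VARIANT); ES-22fα/β are census sub-laws
(NOT IN PRINT).  MECHANISM of ES-22a = connected–étale sequence for φ on E₁ + explicit Kummer generator + Eisenstein-cubic unit filtration + Hilbert-90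
twist + a 64-class residue verification; each lever printed AT 2, the residue identity and the uniform dichotomy not ⇒ house grade NEW-COMBINATION;
beyond-print CANDIDATE YES-SMALL for ES-22a (v39-add1 A1 after REF1 §132: ES-22a is now a WORDS-THEOREM «words-certified (REF1 §132) / placed (REF2 v38
§2, v39-add1: not in print, new-combination, beyond-print-in-words YES-small) / typed def `BlindSpotKummerAtTwoSupersingular`» — a FRONTIER-LEDGER entry;
the KERNEL beyond-print count is unchanged until the typed def is proved as a tree `theorem` or consumed by name in a kernel closer); ES-22e and ES-22b
at Δ ≡ 3 (8): census-grade on the ordinary half until (b2) closes (ρ22-2 = REF1 F132-C) — «beyond-print CANDIDATE yes-small, not confirmed».  ρ22-1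
(CORRECTION, upheld by REF1): for L₂ a cubic field M_{1,2} = 1 ⊊ im δ₂ (order 2) ⊊ M_{2,2} (order 4), so MEMO-es 22.12(c)/22.13 «im δ₂ = M_{1,2}» is
killed as worded (typed Props unaffected; ξ_E ∈ M₁ ⟺ z₂ = 1 ⟺ 8 ∣ b₂ + 2b₄).  Q22 is KNOWN from print: Lawson–Wuthrich 2016 §8 (L(GL₂(ℤ/4)) = 0 ⇒
Ш¹(ℚ,E[4]) = 0 for ρ_{E,4} onto) + Creutz 2016 Thm 2.1 (Ш(E) ⊂ 4·H¹(ℚ,E)).  ES-22h/22.12(a)(b): NOT IN PRINT as statements; corollaries of ES-22e +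
exactness of 0 → E(ℚ)/2 → Sel₂ → Ш[2] → 0 — their interest is as USES of the law.» [cite: LawsonWuthrich2016, §7.1, §8, Thm. 24] [cite: CreutzB2016, Thm. 2.1]
PARTITION: none moved; beyond-print theorem: -es claims YES-small for the STATEMENTS (ES-22a/b/e not in print at p = 2; REF2 v35-add1/v36: local laws
«no» by the v9 §2 mechanism test, the injectivity consequences «yes-small IF kernel-proved»); this file carries defs + kernel glue only ⇒ no
beyond-print THEOREM lands here.  BSD is not proved; 23715 not closed.
bears_on: 23715 (the Δ<0 all-layers U / `stub_doorUpperOffBottom` off the thin family 𝔉; GK2 28029/28030 bit-loss allowance); asks D-es-66 (REF1),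
D-es-66-ty (-ty, this file), D-es-67/69/70 (-data, -desc), placement (iv) (-ref2).

## The sketch's own summary (verbatim)

# MEMO-es §22 (cell `bsd-f1-sign2`, -es g13) — THE SIGNED OBJECT AT `2` FOR THE ČEBOTAREV BLIND SPOT IS THE HASSE INVARIANT:
# `loc₂ ξ_E` is Kummer at `2` iff `E` is SUPERSINGULAR at `2` (good reduction); explicit laws at multiplicative primes

Sketch (statement file + kernel glue; nothing here proves BSD).  Continues the TREE module `F1Sign2/BlindSpotLocalLawsAtTwo.lean` (= g12's `Sketch21.lean`, p652787): its frame declarations `primePlace`, `DiesOnDivisionField`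
and its law `BlindSpotNotKummerAtTwoOrdinary` are imported and opened, not restated; this file's namespace is `…BlindSpotLocalLawsAtTwoGood`).

THE OBJECT.  `ρ̄_{E,2}` onto `GL₂(𝔽₂)`; `ξ_E ∈ H¹(ℚ, E[2])` the unique non-zero class dying on `Γ_{ℚ(E[4])}` = restriction of the universal
class `u ∈ H¹(GL₂(ℤ/4), 𝔽₂²)`, `u(1+2n) = pr_V(n)`; explicitly the class of `α_E = -Δ_E f'(θ)` in `ker(N : L^*/L^{*2} → ℚ^*/ℚ^{*2})`,
`L = ℚ[X]/(f)`, `f = X³ + b₂X² + 8b₄X + 16b₆` (`X = 4x`).  `x_v(E) := [loc_v ξ_E ∈ δ_v(E(ℚ_v)/2)]`, `z_v(E) := [loc_v ξ_E = 0]`.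
The blind-spot bit of the `p = 2` Kolyvagin–McCallum induction is `b(E) = [ξ_E ∈ Sel₂(E)] = [Δ_E < 0]·x_2(E)·∏_{v ∣ Δ, v odd} x_v(E)` (MEMO-es §19–21).

THE LAWS OF §22 (proofs on paper in MEMO-es §22; census = TWO engines, PARI job F21 `j312155` (g12) v. the pure-python `2`-adic
engine `es22/engine22.py` (g13), agreeing on every row: 451 ordinary, 505 supersingular, 849 multiplicative-at-2 curves and 5527
odd multiplicative (curve, prime) instances):
* ES-22a `BlindSpotKummerAtTwoSupersingular` (Λ₂-ss, THEOREM by a 4-class finite `2`-adic verification): good supersingular at `2` ⇒ `x_2 = 1`.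
  Proof: `L ⊗ ℚ₂ = ℚ₂(π)` cubic totally ramified, `π = θ/2` Eisenstein root of `π³ + (b₂/2)π² + 2b₄π + 2b₆`; `δ_2(E(ℚ₂)/2) = {1, κ}`,
  `κ = X - 2π` for any odd `X ≡ 1 - b₂ (mod 8)` (a point of `E₁ ∖ E₂`, `2E₁ = E₂` for the height-`2` formal group, `#Ẽ(𝔽₂)` odd);
  the classes of `α_E = -4Δ(3π² + b₂π + 2b₄)` and `κ` in `ℚ₂(π)^*/ℚ₂(π)^{*2} = (valuation mod 2) × (𝒪/π⁷𝒪)^*/□` depend only on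
  `(b₂ mod 8, b₄ mod 4) ∈ {0,4} × {0,2}` (`b₆ ≡ 1 (4)`, `Δ ≡ 5 (8)` are forced), and in all four classes `α_E ∈ {1, κ}`; moreover
  ES-22a′: `z_2(E) = 1 ⟺ 8 ∣ b₂ + 2b₄`.  Census 505/505 (`z_2`: 308/197 as predicted).
* ES-22b = g12's `BlindSpotNotKummerAtTwoOrdinary` (Λ₂-ord) is now a THEOREM on paper (MEMO-es §22.3): with `T° ∈ E[2](ℚ₂)` the connected point,
  `M = ℚ₂(√Δ)`, `H¹(ℚ₂, E[2]) = ℚ₂^*/□ ×' M^*/□`: (A) the étale shadow `sh(loc₂ ξ_E) = N_{M/ℚ₂}(α_M) ≡ -Δ` (universal cocycle on the Borel of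
  `GL₂(ℤ/4)`); (B) `sh(δ_2(E(ℚ₂))) = δ_φ̂(E(ℚ₂)) = {1, 5}` and `δ_2(E(ℚ₂)) ∩ ι(ℚ₂^*) = ι(ℤ₂^*)` (2-isogeny `E → E/⟨T°⟩` with étale dual
  kernel + Tate-duality orthogonality `δ_φ(E') = δ_φ̂(E)^⊥`); hence `x_2 = 0` for `Δ ≡ 1 (4)` (shadow ramified) and `Δ ≡ 7 (8)`
  (`α ≡ δ(T°)·√Δ ∈ ι(2ℤ₂^*)`); for `Δ ≡ 3 (8)` the unramified twist by `5` (Kramer–Mazur: `δ(E) = δ(E⁵)`, `α` twist-invariant) reduces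
  to `a₂ = +1`, where the rational `4`-torsion point `Q` over `T°` gives the normal form `y² = x(x² + (32μ² + 2Δ'/μ²)x + (16μ² - Δ'/μ²)²)`
  and `⟨α, δ(Q)⟩ = (√Δ', 2(√Δ' + 4μ²))_{ℚ₂(√Δ')} = (2, -Δ')₂ = -1`.  Census 451/451, every intermediate identity checked per curve.
* ES-22c `BlindSpotKummerAtSplitMultiplicativeIff` (THEOREM on paper, any prime `p`): split multiplicative ⇒ `x_p = [-Δ_E ∈ ℚ_p^{*2}]`
  (Tate curve: `δ_p(E(ℚ_p)) = ι(ℚ_p^*/□)` = the étale-shadow kernel; shadow of `ξ_E` is `-Δ ≡ -q`).  In particular `x_p = 0` when `v_p(Δ)` is odd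
  (g12's ES-21a/21b₂, re-proved without the ramification argument).  Census: 415 + 2717 split instances, all `v` odd or `-Δ ∉ □`: `x = 0`.
* ES-22d `BlindSpotKummerAtNonsplitMultiplicativeValFour` (THEOREM-sketch, `p` odd): non-split multiplicative with `4 ∣ v_p(Δ)` ⇒ `x_p = 1`
  (`loc_p ξ_E` unramified since inertia acts through `(1 v;0 1)`, `u(1+2n) = pr_V(n) = (v/2)·T°`; and `δ_p(E(ℚ_p)) = H¹_ur` because every
  `ℚ_p`-point is halved over `ℚ_p^{ur}` when `v/2` is even).  Census 5/5 (thin).  (`v ≡ 2 (4)`: `x_p = [p ≡ 1 (4)]` if `Δ/p^v` is a non-square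
  mod `p`, `0` if it is a square and `p ≡ 1 (4)`; 2/2.)
* ES-22e `BlindSpotKummerAtTwoIffSupersingular` (the dichotomy; kernel glue from ES-22a + ES-22b): at good reduction at `2`,
  `x_2(E) = [E supersingular at 2] = [2 ∣ a₂(E)]` — «the signed object at 2» of the blind spot is the Hasse invariant.  Census 956/956.
REF2 v40-add1 §A3 (refuter-bsd-f1-sign2-ref2 g40, 2026-08-28T19:20:21Z) cite-slot fixes folded by -ty g12 (text only, no statement change):
ES-22d [cite: SilvermanAEC2009, App. C §14, Thm. 14.1 (d)] (twisted Tate curve; App. C has no exercises),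
ES-22fα [cite: YooYu2022, Prop. 1.8 (Barrera Salazar–Pacetti–Tornaría), Prop. 4.4] (arXiv numbering),
ES-22g [cite: Kramer1981, Prop. 6] (Kramer 1981 numbers Props. 1–7 without section prefixes; «3.6» = Brumer–Kramer 1977 Prop. 3.6, no key yet, acq-01909).
-/

set_option autoImplicit false

noncomputable section

open scoped Classical

namespace Summit.BirchSwinnertonDyer.Rank1Residual.F1Sign2.BlindSpotLocalLawsAtTwoGood

open WeierstrassCurve NumberField IsDedekindDomain
open Literature.NumberTheory.EllipticCurves Literature.NumberTheory.EllipticCurves.ModularForms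
open Literature.NumberTheory.GaloisRepresentations
open Summit.BirchSwinnertonDyer.Rank1Residual.F1Sign2.BlindSpotLocalLawsAtTwo

/-! The frame declarations `primePlace`, `DiesOnDivisionField` and g12's Λ₂-ord law `BlindSpotNotKummerAtTwoOrdinary` (ES-21b₁; after MEMO-es §22.3 a
THEOREM on paper for every `Δ mod 8`) are the TREE's (`F1Sign2/BlindSpotLocalLawsAtTwo.lean`, p652787) — opened above, not restated. -/

/-- **ES-22a `BlindSpotKummerAtTwoSupersingular` (Λ₂-ss; candidate, THEOREM by finite `2`-adic verification, NEW as a statement): at good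
SUPERSINGULAR reduction at `2` (`2 ∣ a₂`) the Čebotarev blind spot SATISFIES the local Kummer condition at `2`.**  For `ρ_{E,2^∞}` onto, every
class of `H¹(ℚ, E[2])` dying on `Γ_{ℚ(E[4])}` (i.e. `0` or `ξ_E`) lies in `δ_2(E(ℚ_2)/2) = ker(H¹(ℚ, E[2]) → H¹(ℚ₂, E))`.  Mechanism: in the
cubic ramified `2`-division algebra `ℚ₂(π)`, `π = θ/2`, the Kummer line is `{1, X - 2π}` (`X` odd, `X ≡ 1 - b₂ (8)`) and `α_E = -4Δ(3π² + b₂π + 2b₄)`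
has the same class or is a square; both classes factor through `(b₂ mod 8, b₄ mod 4)` (MEMO-es §22.4 (i)–(v)), and the 4 residue classes are verified THREE
ways: F21 PARI Kummer bases (505/505), engine22 exact `2`-adics (505/505), and the engine-free residue-ring computation `ss_symbolic.py` in the 64-element ring
`ℤ₂[π]/π⁷` (a `decide`-sized check).  Why it might fail: only a slip in the reduction §22.4 (iv) (precision lemma `U^{(7)} ⊂ U²`, `π⁷𝒪 = (8, 4π, 4π²)`).  Cheapest falsifier: ONE supersingular-at-2 curve with onto `ρ_{E,4}` and `x_2 = 0`.
[cite: SilvermanAEC2009, IV.§3, X.§4] [cite: LawsonWuthrich2016, §7.1] -/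
def BlindSpotKummerAtTwoSupersingular : Prop :=
  ∀ (W : WeierstrassCurve ℚ) [W.IsElliptic] [W.IsGloballyMinimal], (∀ n : ℕ, W.HasSurjectiveModNGaloisRep ((2 ^ n : ℕ) : ℤ)) →
    W.HasGoodReductionAtPrime 2 → (2 : ℤ) ∣ W.frobeniusTrace 2 →
    ∀ x : galH1Torsion W ((2 ^ 1 : ℕ) : ℤ), DiesOnDivisionField W 1 2 x →
      x ∈ selmerLocalKer W ((primePlace 2).adicCompletion ℚ) ((2 ^ 1 : ℕ) : ℤ)

/-- **ES-22a′ `BlindSpotLocallyTrivialAtTwoSupersingularIff` (z₂-law; candidate, THEOREM by the same finite verification, NEW): at good supersingular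
reduction at `2`, `loc₂ ξ_E = 0` in `H¹(ℚ₂, E[2])` iff `8 ∣ b₂ + 2b₄` on the minimal model** (`b₂ ≡ 0 (4)`, `b₄` even there).  Census F21 v. engine22:
`z_2 = 1` on exactly the 308 = 101 + 207 curves with `(b₂, b₄) ≡ (0,0), (4,2) (mod 8, mod 4)`, `z_2 = 0` on the 197 = 75 + 122 others.
`b₂ + 2b₄ mod 8` is invariant under `[±1; r, s, t]` (`12r(r+1) + 2rb₂ ≡ 0 (8)`), so the statement does not depend on the minimal model.  Why it might fail: as ES-22a.
[cite: SilvermanAEC2009, X.§1 Thm. 1.1] -/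
def BlindSpotLocallyTrivialAtTwoSupersingularIff : Prop :=
  ∀ (W : WeierstrassCurve ℚ) [W.IsElliptic] [W.IsGloballyMinimal], (∀ n : ℕ, W.HasSurjectiveModNGaloisRep ((2 ^ n : ℕ) : ℤ)) →
    W.HasGoodReductionAtPrime 2 → (2 : ℤ) ∣ W.frobeniusTrace 2 →
    ∀ x : galH1Torsion W ((2 ^ 1 : ℕ) : ℤ), x ≠ 0 → DiesOnDivisionField W 1 2 x →
      (resTorsion W ((primePlace 2).adicCompletion ℚ) ((2 ^ 1 : ℕ) : ℤ) x = 0 ↔ ∃ k : ℤ, W.b₂ + 2 * W.b₄ = 8 * k)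

/-- **ES-22c `BlindSpotKummerAtSplitMultiplicativeIff` (candidate, THEOREM on paper, NEW; any prime `p`): at SPLIT multiplicative reduction the blind
spot is Kummer at `p` iff `-Δ_E` is a square in `ℚ_p`.**  Mechanism: Tate curve, `δ_p(E(ℚ_p)/2) = ι(ℚ_p^*/ℚ_p^{*2})` = kernel of the étale shadow
`sh : H¹(ℚ_p, E[2]) → H¹(ℚ_p, E[2]/μ₂) = ℚ_p^*/□`, and `sh(loc_p ξ_E) = χ_{-Δ}` (universal cocycle on the Borel).  In particular `x_p = 0` whenever
`v_p(Δ)` is odd (g12 ES-21a split half, ES-21b₂).  Census: 415 curves split at `2` + 2717 odd split instances (all with `v` odd or `-Δ/p^v` a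
non-residue): `x = 0`, as predicted; NO instance with `-Δ ∈ ℚ_p^{*2}` in the table (prediction `x_p = 1` there untested).  Why it might fail: the
`x_p = 1` half rests on the cocycle identity `sh(u|_B) = [det = -1] + β̄` alone.  Cheapest falsifier: a split-multiplicative `p` with `-Δ ∈ ℚ_p^{*2}`, `x_p = 0`.
[cite: SilvermanAEC2009, C.14 Thm. 14.1] [cite: LawsonWuthrich2016, §7.1] -/
def BlindSpotKummerAtSplitMultiplicativeIff : Prop :=
  ∀ (W : WeierstrassCurve ℚ) [W.IsElliptic] [W.IsGloballyMinimal], (∀ n : ℕ, W.HasSurjectiveModNGaloisRep ((2 ^ n : ℕ) : ℤ)) →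
    ∀ (p : ℕ) [Fact p.Prime], W.HasSplitMultiplicativeReductionAtPrime p →
    ∀ x : galH1Torsion W ((2 ^ 1 : ℕ) : ℤ), x ≠ 0 → DiesOnDivisionField W 1 2 x →
      (x ∈ selmerLocalKer W ((primePlace p).adicCompletion ℚ) ((2 ^ 1 : ℕ) : ℤ) ↔
        IsSquare (algebraMap ℚ ((primePlace p).adicCompletion ℚ) (-W.Δ)))

/-- **ES-22d `BlindSpotKummerAtNonsplitMultiplicativeValFour` (candidate, THEOREM-sketch, NEW; `p` odd): at NON-SPLIT multiplicative reduction with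
`4 ∣ v_p(Δ)` the blind spot satisfies the local Kummer condition** (`loc_p ξ_E ∈ H¹_ur = δ_p(E(ℚ_p)/2)`).  Census 5/5 odd instances (thin; no `p = 2`
analogue: 0/2 there).  Why it might fail: the identification `δ_p(E(ℚ_p)) = H¹_ur` for the twisted Tate curve with `v/2` even (halving over `ℚ_p^{ur}`).
Cheapest falsifier: one non-split `I_{4m}` odd prime with `x_p = 0`. [cite: SilvermanAEC2009, App. C §14, Thm. 14.1 (d)] [cite: LawsonWuthrich2016, §7.1] -/
def BlindSpotKummerAtNonsplitMultiplicativeValFour : Prop :=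
  ∀ (W : WeierstrassCurve ℚ) [W.IsElliptic] [W.IsGloballyMinimal], (∀ n : ℕ, W.HasSurjectiveModNGaloisRep ((2 ^ n : ℕ) : ℤ)) →
    ∀ (p : ℕ) [Fact p.Prime], p ≠ 2 → W.HasMultiplicativeReductionAtPrime p → ¬ W.HasSplitMultiplicativeReductionAtPrime p →
    (4 : ℤ) ∣ padicValRat p W.Δ →
    ∀ x : galH1Torsion W ((2 ^ 1 : ℕ) : ℤ), DiesOnDivisionField W 1 2 x →
      x ∈ selmerLocalKer W ((primePlace p).adicCompletion ℚ) ((2 ^ 1 : ℕ) : ℤ)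

/-- **ES-22e `BlindSpotKummerAtTwoIffSupersingular` (THE DICHOTOMY at good reduction at `2`; candidate = ES-22a ∧ ES-22b): for `ρ_{E,2^∞}` onto and
good reduction at `2`, the non-zero class dying on `ℚ(E[4])` is Kummer at `2` iff `2 ∣ a₂(E)` (supersingular).**  «The signed object at 2» of the
Čebotarev blind spot is the Hasse invariant.  Census 956/956 (451 ordinary `x_2 = 0`, 505 supersingular `x_2 = 1`), two engines.
[cite: LawsonWuthrich2016, §7.1] [cite: SilvermanAEC2009, X.§4] -/
def BlindSpotKummerAtTwoIffSupersingular : Prop :=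
  ∀ (W : WeierstrassCurve ℚ) [W.IsElliptic] [W.IsGloballyMinimal], (∀ n : ℕ, W.HasSurjectiveModNGaloisRep ((2 ^ n : ℕ) : ℤ)) →
    W.HasGoodReductionAtPrime 2 →
    ∀ x : galH1Torsion W ((2 ^ 1 : ℕ) : ℤ), x ≠ 0 → DiesOnDivisionField W 1 2 x →
      (x ∈ selmerLocalKer W ((primePlace 2).adicCompletion ℚ) ((2 ^ 1 : ℕ) : ℤ) ↔ (2 : ℤ) ∣ W.frobeniusTrace 2)

/-- Glue (kernel): the dichotomy from Λ₂-ss (ES-22a) and Λ₂-ord (ES-22b = g12 ES-21b₁ at level `(1,2)`). -/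
theorem blindSpotKummerAtTwoIffSupersingular_of (hss : BlindSpotKummerAtTwoSupersingular) (hord : BlindSpotNotKummerAtTwoOrdinary) :
    BlindSpotKummerAtTwoIffSupersingular := by
  intro W _ _ hsurj hgood x hx hdies
  constructor
  · intro hloc
    by_contra hdiv
    have hordW : IsOrdinaryAt W 2 := (isOrdinaryAt_iff W 2).2 ⟨hgood, hdiv⟩
    exact hx (hord W hsurj hordW 1 2 le_rfl (by norm_num) le_rfl x hloc hdies)
  · intro hdiv
    exact hss W hsurj hgood hdiv x hdies

/-- Glue (kernel): at good reduction at `2` the blind-spot bit `x_2` is DECIDED by the reduction type — the ordinary law in its `(j,k) = (1,2)` instance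
is the negation of the Kummer condition for the non-zero dying class. -/
theorem not_mem_selmerLocalKer_of_ordinary (hord : BlindSpotNotKummerAtTwoOrdinary) (W : WeierstrassCurve ℚ) [W.IsElliptic] [W.IsGloballyMinimal]
    (hsurj : ∀ n : ℕ, W.HasSurjectiveModNGaloisRep ((2 ^ n : ℕ) : ℤ)) (hordW : IsOrdinaryAt W 2)
    (x : galH1Torsion W ((2 ^ 1 : ℕ) : ℤ)) (hx : x ≠ 0) (hdies : DiesOnDivisionField W 1 2 x) :
    x ∉ selmerLocalKer W ((primePlace 2).adicCompletion ℚ) ((2 ^ 1 : ℕ) : ℤ) :=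
  fun hloc ↦ hx (hord W hsurj hordW 1 2 le_rfl (by norm_num) le_rfl x hloc hdies)

/-- Glue (kernel): ES-22c contains the split half of g12's odd-valuation laws — if `-Δ` is not a square in `ℚ_p` (e.g. `v_p(Δ)` odd) then the
blind spot fails the Kummer condition at a split multiplicative `p`. -/
theorem eq_zero_of_split_of_not_isSquare (hsplit : BlindSpotKummerAtSplitMultiplicativeIff) (W : WeierstrassCurve ℚ) [W.IsElliptic]
    [W.IsGloballyMinimal] (hsurj : ∀ n : ℕ, W.HasSurjectiveModNGaloisRep ((2 ^ n : ℕ) : ℤ)) (p : ℕ) [Fact p.Prime]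
    (hsp : W.HasSplitMultiplicativeReductionAtPrime p) (hns : ¬ IsSquare (algebraMap ℚ ((primePlace p).adicCompletion ℚ) (-W.Δ)))
    (x : galH1Torsion W ((2 ^ 1 : ℕ) : ℤ)) (hloc : x ∈ selmerLocalKer W ((primePlace p).adicCompletion ℚ) ((2 ^ 1 : ℕ) : ℤ))
    (hdies : DiesOnDivisionField W 1 2 x) : x = 0 := by
  by_contra hx
  exact hns ((hsplit W hsurj p hsp x hx hdies).1 hloc)

/-! ## Global consequences on the THIN FAMILY `𝔉` (MEMO-es §22.12): good reduction at `2`, every odd bad prime additive, odd Tamagawa product,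
`Δ < 0`, `ρ_{E,2^∞}` onto.  On `𝔉` every local bit of the blind spot other than `x_2` equals `1` (∞: `Δ < 0`; additive odd `p` with `c_p` odd:
`E(ℚ_p)[2] ↪ Φ_p(𝔽_p)` of odd order, so `H¹(ℚ_p, E[2]) = 0`; good odd `p ≠ 2`: unramified = Kummer), hence `b(E) = x_2(E) = [E supersingular at 2]`.
Census (Cremona `allbsd`/`allgens`, ALL `574 222` curves of odd conductor `< 500 000`; `family_F.py`, exact arithmetic in `L = ℚ(θ)`):
`𝔉_ss` = 52 curves: rank 0 (12): `Ш_an ∈ {4 (7×), 16 (4×), 100 (1×)}` — all divisible by `4`; rank 1 (32): `ξ_E = δ(P_gen)` with a CERTIFIED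
square root `γ² = (4x(P_gen) − θ)·(−Δ f′(θ))` in `L`, 32/32; rank 2 (8): `ξ_E ∈ δ(E(ℚ))`, 8/8.  CONTROL `𝔉_ord` (same conditions, ordinary at 2) = 80 curves:
rank 0 (56): `Ш_an ∈ {1 (52×), 9, 9, 25, 49}` — all odd; rank 1 (24): `ξ_E ∉ δ(E(ℚ))`, 24/24.  132/132 as predicted, by GLOBAL invariants
independent of every local engine. -/

/-- **ES-22g `BlindSpotSelmerIffSupersingularOnThinFamily` (GLOBAL LAW on the thin family; candidate, THEOREM on paper from ES-22a/b + the trivial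
laws at ∞ and at additive primes with odd `c_p`; NEW): for `E/ℚ` globally minimal with `ρ_{E,2^∞}` onto, good reduction at `2`, no multiplicative prime,
odd Tamagawa product and `Δ_E < 0`, the blind-spot class `ξ_E` (the non-zero class of `H¹(ℚ, E[2])` dying on `Γ_{ℚ(E[4])}`) is `2`-SELMER iff `E` is
SUPERSINGULAR at `2`.**  Census 132/132 (52 supersingular + 80 ordinary curves, all of Cremona's table; see the section docstring).  Why it might fail:
an additive odd prime `p = 3` with wild ramification where `E(ℚ_3)[2] ≠ 0` despite `c_3` odd (excluded: `E(ℚ_p)[2] ↪ E(ℚ_p)/E₀(ℚ_p) × Ẽ_ns(𝔽_p) × Ê(pℤ_p)`,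
all three of odd order / `2`-torsion-free for additive `p` odd with `c_p` odd).  Cheapest falsifier: one `𝔉_ss` curve of rank 1 with `Ш_an` odd and
`ξ_E ≠ δ(P_gen)` (run: 0/32), or one `𝔉_ord` curve with `ξ_E ∈ δ(E(ℚ))` (run: 0/24).
[cite: SilvermanAEC2009, VII.§6, X.§4] [cite: Kramer1981, Prop. 6] -/
def BlindSpotSelmerIffSupersingularOnThinFamily : Prop :=
  ∀ (W : WeierstrassCurve ℚ) [W.IsElliptic] [W.IsGloballyMinimal], (∀ n : ℕ, W.HasSurjectiveModNGaloisRep ((2 ^ n : ℕ) : ℤ)) →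
    W.HasGoodReductionAtPrime 2 → (∀ (p : ℕ) [Fact p.Prime], ¬ W.HasMultiplicativeReductionAtPrime p) → Odd W.tamagawaProduct → W.Δ < 0 →
    ∀ x : galH1Torsion W ((2 ^ 1 : ℕ) : ℤ), x ≠ 0 → DiesOnDivisionField W 1 2 x →
      (x ∈ selmerGroup W ((2 ^ 1 : ℕ) : ℤ) ↔ (2 : ℤ) ∣ W.frobeniusTrace 2)

/-- **ES-22h `ShaTwoNontrivialOfSupersingularOnThinFamily` (UNCONDITIONAL COROLLARY, candidate, NEW): on the thin family, SUPERSINGULAR at `2` and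
`E(ℚ)` of rank `0` force `Ш(E/ℚ)[2] ≠ 0`** — the blind-spot class is Selmer (ES-22g) and is not a Kummer image (`E(ℚ)/2E(ℚ) = 0` as `E(ℚ)[2] = 0`),
so its image in `H¹(ℚ, E)` is a non-zero element of `Ш[2]`.  BSD-consistency census: the 12 rank-0 curves of `𝔉_ss` in Cremona's table have
`Ш_an ∈ {4, 16, 100}`; the 56 rank-0 curves of the ordinary control have odd `Ш_an`.  Why it might fail: only through ES-22g.  Cheapest falsifier: a rank-0
`𝔉_ss` curve with `Ш_an` odd (0/12) — which would contradict BSD at `2` or the law.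
[cite: SilvermanAEC2009, Thm X.4.2] -/
def ShaTwoNontrivialOfSupersingularOnThinFamily : Prop :=
  ∀ (W : WeierstrassCurve ℚ) [W.IsElliptic] [W.IsGloballyMinimal], (∀ n : ℕ, W.HasSurjectiveModNGaloisRep ((2 ^ n : ℕ) : ℤ)) →
    W.HasGoodReductionAtPrime 2 → (∀ (p : ℕ) [Fact p.Prime], ¬ W.HasMultiplicativeReductionAtPrime p) → Odd W.tamagawaProduct → W.Δ < 0 →
    (2 : ℤ) ∣ W.frobeniusTrace 2 → W.mordellWeilRank = 0 →
      ∃ s : W.galH1, s ∈ W.sha ∧ s ≠ 0 ∧ (2 : ℤ) • s = 0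

/-- **ES-22i `BlindSpotIsKummerImageOfSupersingularOfShaTwoTrivial` (the RANK-ONE READING, candidate, NEW): on the thin family, supersingular at `2`
and `Ш(E)[2] = 0` force `ξ_E ∈ δ(E(ℚ)/2E(ℚ))` — some rational point not in `2E(ℚ)` becomes `2`-divisible over `ℚ(E[4])`; for rank one:
`ξ_E = δ(P_gen)`.**  Typed as: the image of `ξ_E` in `H¹(ℚ, E)` vanishes.  Census: 32/32 rank-1 and 8/8 rank-2 curves of `𝔉_ss` (certified square
roots in `ℚ(θ)`).  Why it might fail: only through ES-22g.  [cite: SilvermanAEC2009, Thm X.4.2] -/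
def BlindSpotIsKummerImageOfSupersingularOfShaTwoTrivial : Prop :=
  ∀ (W : WeierstrassCurve ℚ) [W.IsElliptic] [W.IsGloballyMinimal], (∀ n : ℕ, W.HasSurjectiveModNGaloisRep ((2 ^ n : ℕ) : ℤ)) →
    W.HasGoodReductionAtPrime 2 → (∀ (p : ℕ) [Fact p.Prime], ¬ W.HasMultiplicativeReductionAtPrime p) → Odd W.tamagawaProduct → W.Δ < 0 →
    (2 : ℤ) ∣ W.frobeniusTrace 2 → (∀ s : W.galH1, s ∈ W.sha → (2 : ℤ) • s = 0 → s = 0) →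
    ∀ x : galH1Torsion W ((2 ^ 1 : ℕ) : ℤ), DiesOnDivisionField W 1 2 x →
      torsionH1ToH1 W ((2 ^ 1 : ℕ) : ℤ) x = 0

/-- Glue (kernel): ES-22i follows from ES-22g and the PROVED Kummer-sequence theorem `WeierstrassCurve.map_torsionH1ToH1_selmerGroup_holds` (`Sel₂ ↠ Ш[2]`, `SelmerProofs`). -/
theorem blindSpotIsKummerImage_of (hg : BlindSpotSelmerIffSupersingularOnThinFamily) :
    BlindSpotIsKummerImageOfSupersingularOfShaTwoTrivial := by
  intro W _ _ hsurj hgood hnomult hodd hneg hss hsha0 x hdies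
  by_cases hx : x = 0
  · subst hx; simp
  have hsel : x ∈ selmerGroup W ((2 ^ 1 : ℕ) : ℤ) := (hg W hsurj hgood hnomult hodd hneg x hx hdies).2 hss
  have hmem : torsionH1ToH1 W ((2 ^ 1 : ℕ) : ℤ) x ∈ (selmerGroup W ((2 ^ 1 : ℕ) : ℤ)).map (torsionH1ToH1 W ((2 ^ 1 : ℕ) : ℤ)) :=
    AddSubgroup.mem_map_of_mem _ hsel
  rw [WeierstrassCurve.map_torsionH1ToH1_selmerGroup_holds W (by norm_num)] at hmem
  obtain ⟨hsha1, htor⟩ := AddSubgroup.mem_inf.1 hmem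
  exact hsha0 _ hsha1 (by simpa using htor)

/-! ## Head start on the additive-at-2 law (MEMO-es §22.13; g14's target): two pure cells of the `c₂`-odd table, typed. -/

/-- **ES-22fα `BlindSpotNotKummerAtTwoAdditiveUnramifiedCubic` (candidate, EMPIRICAL 193/193, NEW): additive reduction at `2` with odd `c₂`, no `ℚ₂`-rational `2`-torsion
and `Δ ∈ 4^k·(1 + 8ℤ)` (so `L ⊗ ℚ₂` is the UNRAMIFIED cubic field) ⇒ the blind spot FAILS the Kummer condition at `2` (`x₂ = 0`).**  Since `L₂` is a cubic field, `E` is «nice at 2»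
[cite: YooYu2022, Prop. 1.8 (Barrera Salazar–Pacetti–Tornaría), Prop. 4.4], so the statement says `L₂(√(−Δ·f′(θ)))/L₂` is ramified.  Census: F21 cells I0*(6,10), II(4,4), IV(2,4) with `u ≡ 1 (8)`: 26 + 60 + 107, all `x₂ = 0`.
Why it might fail: it is mined from 193 rows of three Kodaira types; a IV* or II* curve with unramified cubic `L₂` (absent from the sample) could behave differently.  Cheapest falsifier: one
such curve with `x₂ = 1` (PARI, seconds). -/
def BlindSpotNotKummerAtTwoAdditiveUnramifiedCubic : Prop :=
  ∀ (W : WeierstrassCurve ℚ) [W.IsElliptic] [W.IsGloballyMinimal], (∀ n : ℕ, W.HasSurjectiveModNGaloisRep ((2 ^ n : ℕ) : ℤ)) →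
    ¬ W.HasGoodReductionAtPrime 2 → ¬ W.HasMultiplicativeReductionAtPrime 2 → Odd ((W.baseChange ℚ_[2]).localTamagawaNumber ℤ_[2]) →
    (∀ P : (W.baseChange ℚ_[2]).toAffine.Point, 2 • P = 0 → P = 0) →
    (∃ (k : ℕ) (m : ℤ), W.Δ = (4 : ℚ) ^ k * m ∧ m % 8 = 1) →
    ∀ x : galH1Torsion W ((2 ^ 1 : ℕ) : ℤ), x ∈ selmerLocalKer W ((primePlace 2).adicCompletion ℚ) ((2 ^ 1 : ℕ) : ℤ) →
      DiesOnDivisionField W 1 2 x → x = 0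

/-- **ES-22fβ `BlindSpotKummerAtTwoAdditiveTameCubic` (candidate, EMPIRICAL 265/265, NEW): additive reduction at `2` with odd `c₂`, no `ℚ₂`-rational `2`-torsion,
`Δ ∈ 4^k·(5 + 8ℤ)` (so `L ⊗ ℚ₂` is a totally, tamely ramified cubic field with `S₃`-closure through `ℚ₂(√5)`) and `v₂(Δ) ≠ 6` ⇒ the blind spot SATISFIES the Kummer condition at `2`
(`x₂ = 1`; equivalently `L₂(√(−Δ·f′(θ)))/L₂` unramified).**  Census: F21 cells I0*(4,8) 35, II*(4,12) 65, II*(6,14) 23, IV*(2,8) 142, all `x₂ = 1`; the EXCLUDED cell `v₂(Δ) = 6`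
(Kodaira II) is mixed 29/26.  Why it might fail: the mixed II cell shows a finer invariant is at work; it may also act at `v₂(Δ) ∈ {8, 12, 14}` outside the 265 sampled curves.  Cheapest
falsifier: one tame-cubic curve with `v₂(Δ) = 8` and `x₂ = 0`. -/
def BlindSpotKummerAtTwoAdditiveTameCubic : Prop :=
  ∀ (W : WeierstrassCurve ℚ) [W.IsElliptic] [W.IsGloballyMinimal], (∀ n : ℕ, W.HasSurjectiveModNGaloisRep ((2 ^ n : ℕ) : ℤ)) →
    ¬ W.HasGoodReductionAtPrime 2 → ¬ W.HasMultiplicativeReductionAtPrime 2 → Odd ((W.baseChange ℚ_[2]).localTamagawaNumber ℤ_[2]) →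
    (∀ P : (W.baseChange ℚ_[2]).toAffine.Point, 2 • P = 0 → P = 0) →
    (∃ (k : ℕ) (m : ℤ), W.Δ = (4 : ℚ) ^ k * m ∧ m % 8 = 5) → padicValRat 2 W.Δ ≠ 6 →
    ∀ x : galH1Torsion W ((2 ^ 1 : ℕ) : ℤ), DiesOnDivisionField W 1 2 x →
      x ∈ selmerLocalKer W ((primePlace 2).adicCompletion ℚ) ((2 ^ 1 : ℕ) : ℤ)

end Summit.BirchSwinnertonDyer.Rank1Residual.F1Sign2.BlindSpotLocalLawsAtTwoGood
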